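import Literature.NumberTheory.Sieve.FGKMT2018GoodPrimes
import HarnessLib

/-!
# Ford–Green–Konyagin–Maynard–Tao 2018 — §6, Lemma 6.2 / (6.14): first and second moments of the
# covering sums `Σ_i Σ_p Z_p(a⃗; q − h_i p)` over the uniform residue box (PROVED, explicit constants)

Topic `Literature/NumberTheory/Sieve`. Source: K. Ford, B. Green, S. Konyagin, J. Maynard, T. Tao,
*Long gaps between primes*, J. Amer. Math. Soc. 31 (2018) 65–105 = arXiv:1412.5029, §6 pp. 18–19
[FordGreenKonyaginMaynardTao2018]. Lemma 6.2: «With probability `1 − o(1)`, we have (6.14)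
`σ^{-r} Σ_{i=1}^r Σ_{p ∈ 𝒫(a⃗)} Z_p(a⃗; q − h_i p) = (1 + O_≤(1/log₂³ x)) (u/σ) (x/2y)` for all but
at most `x/(2 log x log₂ x)` of the primes `q ∈ 𝒬 ∩ S(a⃗)`»; proof (p. 19): «Call a prime `q ∈ 𝒬`
bad if `q ∈ 𝒬 ∩ S(a⃗)` but (6.14′) fails. Using Lemma 6.1 and (6.4), (6.6) we have
`E[Σ_{q ∈ 𝒬 ∩ S(a⃗)} Σ_i Σ_p Z_p(a⃗; q − h_i p)] = Σ_{q,i,p} P(q + (h_j − h_i) p ∈ S(a⃗) for all j)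
P(ñ_p = q − h_i p) = (1 + O(log₂^{-10} x)) (σy/log x) σ^{r−1} u x/(2y)` and
`E[Σ_{q ∈ 𝒬 ∩ S(a⃗)} (Σ_i Σ_p Z_p(a⃗; q − h_i p))²] = Σ_{p₁,p₂,q,i₁,i₂} P(q + (h_j − h_{i_l}) p_l ∈ S(a⃗)
for j = 1..r; l = 1, 2) P(ñ^{(1)}_{p₁} = q − h_{i₁} p₁) P(ñ^{(2)}_{p₂} = q − h_{i₂} p₂)
= (1 + O(log₂^{-10} x)) (σy/log x) (σ^{r−1} u x/(2y))²,
… In the last step we used the fact that the terms with `p₁ = p₂` contribute negligibly.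
By Chebyshev's inequality it follows that the number of bad `q` is `≪ (σy/log x) log₂^{-3} x`
with probability `1 − O(1/log₂ x)`.»

This file PROVES the engine of this computation, with explicit constants, for general laws
`λ_p = P(ñ_p = ·)` (`λ ≥ 0`, `λ ≤ Λ`), prime set `P ∌ 0`, shift set `H` (`#H = r ≥ 1`), target set
`Q ⊆ ℤ` and prime moduli `S ∋ s ≥ s₀` (the box of `FGKMT2018UniformSieve`):
* `Ylaw` = `Y_q(a⃗) := Σ_{(h,p) ∈ H × P} λ_p(q − hp) 1_{T ⊆ S(a⃗)}`, `T = {q − hp + h'p : h' ∈ H}`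
  (`= Σ_i Σ_p Z_p(a⃗; q − h_i p)`, `Ylaw_eq_sum_Zp`), and `Alaw q = Σ_{(h,p)} λ_p(q − hp)`
  (`= (1 + O(log₂^{-10} x)) u x/(2y)` by (6.6) in the application);
* `siftInd_singleton_mul_Ylaw` — `1_{q ∈ S(a⃗)} Y_q = Y_q` (each `T ∋ q`);
* `boxExp_Ylaw`, `boxExp_Ylaw_ge/le` — `σ^r e^{-2r²Σ1/s²} A_q ≤ E Y_q ≤ σ^r A_q/(1 − δ_r)`;
* `boxExp_Ylaw_sq_le` — `E Y_q² ≤ A_q (σ^{2r−1} A_q + σ^r r Λ)/(1 − δ_{2r})`, using the cross-prime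
  hypothesis `hcross` (`(h₁' − h₁) p₁ = (h₂' − h₂) p₂`, `p₁ ≠ p₂` ⟹ `h₁' = h₁`; in the application
  `|h − h'| ≤ 2r² < p`) to get `#(T₁ ∪ T₂) ≥ 2r − 1` for `p₁ ≠ p₂`;
* `boxExp_sum_sq_dev_le` — `E Σ_{q ∈ Q ∩ S(a⃗)} (Y_q − σ^{r−1} m)²` for `A_q = (1 + O_≤(ε)) m`;
* `count_box_sq_dev` (Markov over `a⃗`) and `card_bad_le` (Chebyshev over `q`, deterministic).
-/

noncomputable section

open Finset

namespace Literature.NumberTheory.Sieve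

namespace FGKMT2018

/-! ### A monotone form of the upper bound of Lemma 6.1 -/

/-- Lemma 6.1 upper bound for `k ≤ #T ≤ K ≤ s₀`: `P(T ⊆ S(a⃗)) ≤ σ^k/(1 − δ_K)`,
`δ_K = K³ log M/(s₀ log s₀)`. [cite: FordGreenKonyaginMaynardTao2018, Lemma 6.1 p. 17] -/
theorem lemma61_upper_mono {S : Finset ℕ} (hS : ∀ s ∈ S, s.Prime) {s₀ : ℕ} (hs₀ : 2 ≤ s₀)
    (hSs₀ : ∀ s ∈ S, s₀ ≤ s) {T : Finset ℤ} {M : ℝ} (hM1 : 1 ≤ M)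
    (hM : ∀ n ∈ T, ∀ n' ∈ T, (|n - n'| : ℝ) ≤ M) {k K : ℕ} (hk : k ≤ #T) (hK : #T ≤ K)
    (hKs₀ : K ≤ s₀) (hδ : (K : ℝ) ^ 3 * Real.log M / (s₀ * Real.log s₀) < 1) :
    siftProb S T ≤ sigmaProd S ^ k / (1 - (K : ℝ) ^ 3 * Real.log M / (s₀ * Real.log s₀)) := by
  have hS0 : ∀ s ∈ S, 0 < s := fun s hs => (hS s hs).pos
  have hσ0 : 0 ≤ sigmaProd S := sigmaProd_nonneg hS0
  have hσ1 : sigmaProd S ≤ 1 := sigmaProd_le_one hS0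
  have hs₀pos : (0 : ℝ) < s₀ := by exact_mod_cast (show 0 < s₀ by omega)
  have hlogs₀ : 0 < Real.log s₀ := Real.log_pos (by exact_mod_cast (show 1 < s₀ by omega))
  have hden : 0 < (s₀ : ℝ) * Real.log s₀ := mul_pos hs₀pos hlogs₀
  have hlogM : 0 ≤ Real.log M := Real.log_nonneg hM1
  have hδle : (#T : ℝ) ^ 3 * Real.log M / (s₀ * Real.log s₀) ≤
      (K : ℝ) ^ 3 * Real.log M / (s₀ * Real.log s₀) := by
    refine div_le_div_of_nonneg_right (mul_le_mul_of_nonneg_right ?_ hlogM) hden.le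
    exact pow_le_pow_left₀ (Nat.cast_nonneg _) (by exact_mod_cast hK) 3
  have h := lemma61_upper hS hs₀ hSs₀ hM1 hM (hK.trans hKs₀) (lt_of_le_of_lt hδle hδ)
  refine h.trans ?_
  have h1 : 0 < 1 - (K : ℝ) ^ 3 * Real.log M / (s₀ * Real.log s₀) := by linarith
  calc sigmaProd S ^ #T / (1 - (#T : ℝ) ^ 3 * Real.log M / (s₀ * Real.log s₀))
        ≤ sigmaProd S ^ k / (1 - (#T : ℝ) ^ 3 * Real.log M / (s₀ * Real.log s₀)) :=
          div_le_div_of_nonneg_right (pow_le_pow_of_le_one hσ0 hσ1 hk) (by linarith)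
    _ ≤ sigmaProd S ^ k / (1 - (K : ℝ) ^ 3 * Real.log M / (s₀ * Real.log s₀)) :=
          div_le_div_of_nonneg_left (pow_nonneg hσ0 _) h1 (by linarith)

/-! ### The covering sums `Y_q` -/

/-- The shifted set attached to the pair `(h, p)` at `q`: `{q − hp + h'p : h' ∈ H} = {q + (h' − h)p}`.
[cite: FordGreenKonyaginMaynardTao2018, Lemma 6.2 (proof) p. 19] -/
def pairSet (H : Finset ℤ) (q : ℤ) (i : ℤ × ℕ) : Finset ℤ :=
  shiftSet H i.2 (q - i.1 * (i.2 : ℤ))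

/-- `Y_q(a⃗) := Σ_{(h,p) ∈ H × P} λ_p(q − hp) 1_{ {q − hp + h'p : h'} ⊆ S(a⃗)}` (box format);
`= Σ_i Σ_{p} Z_p(a⃗; q − h_i p)` for `λ_p = P(ñ_p = ·)` (`Ylaw_eq_sum_Zp`).
[cite: FordGreenKonyaginMaynardTao2018, (6.14) p. 18] -/
def Ylaw (S : Finset ℕ) (P : Finset ℕ) (H : Finset ℤ) (lam : ℕ → ℤ → ℝ)
    (f : (s : ℕ) → s ∈ S → ℕ) (q : ℤ) : ℝ :=
  ∑ i ∈ H ×ˢ P, lam i.2 (q - i.1 * (i.2 : ℤ)) * siftInd S (pairSet H q i) f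

/-- `A_q := Σ_{(h,p) ∈ H × P} λ_p(q − hp)` (`= Σ_i Σ_p P(q = ñ_p + h_i p) = (1 + O(log₂^{-10} x)) u x/(2y)`
by (6.6)). [cite: FordGreenKonyaginMaynardTao2018, (6.6) p. 17] -/
def Alaw (P : Finset ℕ) (H : Finset ℤ) (lam : ℕ → ℤ → ℝ) (q : ℤ) : ℝ :=
  ∑ i ∈ H ×ˢ P, lam i.2 (q - i.1 * (i.2 : ℤ))

variable {S : Finset ℕ} {P : Finset ℕ} {H : Finset ℤ} {lam : ℕ → ℤ → ℝ}

/-- Bridge to (6.12): `Y_q(a⃗) = Σ_{h ∈ H} Σ_{p ∈ P} Z_p(a⃗; q − hp)` for `a⃗ = extendRes 𝒮 f`.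
[cite: FordGreenKonyaginMaynardTao2018, (6.14) p. 18] -/
theorem Ylaw_eq_sum_Zp {x : ℕ} (P : Finset ℕ) (H : Finset ℤ) (w : ℕ → ℤ → ℝ) (N : Finset ℤ)
    (f : (s : ℕ) → s ∈ primesS x → ℕ) (q : ℤ) :
    Ylaw (primesS x) P H (fun p n => lawTilde w N p n) f q =
      ∑ h ∈ H, ∑ p ∈ P, Zp x (extendRes (primesS x) f) H w N p (q - h * (p : ℤ)) := by
  unfold Ylaw
  rw [Finset.sum_product]
  refine Finset.sum_congr rfl fun h _ => Finset.sum_congr rfl fun p _ => ?_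
  rw [Zp_extendRes, mul_comm]
  rfl

/-- [cite: FordGreenKonyaginMaynardTao2018, (6.6) p. 17] -/
theorem Alaw_eq_sum (P : Finset ℕ) (H : Finset ℤ) (lam : ℕ → ℤ → ℝ) (q : ℤ) :
    Alaw P H lam q = ∑ h ∈ H, ∑ p ∈ P, lam p (q - h * (p : ℤ)) := by
  unfold Alaw
  rw [Finset.sum_product]

/-- [cite: FordGreenKonyaginMaynardTao2018, (6.6) p. 17] -/
theorem Alaw_nonneg (hlam : ∀ p n, 0 ≤ lam p n) (q : ℤ) : 0 ≤ Alaw P H lam q :=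
  Finset.sum_nonneg fun _ _ => hlam _ _

/-- [cite: FordGreenKonyaginMaynardTao2018, (6.14) p. 18] -/
theorem Ylaw_nonneg (hlam : ∀ p n, 0 ≤ lam p n) (f : (s : ℕ) → s ∈ S → ℕ) (q : ℤ) :
    0 ≤ Ylaw S P H lam f q :=
  Finset.sum_nonneg fun _ _ => mul_nonneg (hlam _ _) (siftInd_nonneg S _ f)

/-- `q ∈ {q − hp + h'p : h' ∈ H}` (take `h' = h`). [cite: FordGreenKonyaginMaynardTao2018, Lemma 6.2 (proof) p. 19] -/
theorem self_mem_pairSet {q : ℤ} {i : ℤ × ℕ} (hi : i.1 ∈ H) : q ∈ pairSet H q i :=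
  mem_shiftSet.2 ⟨i.1, hi, by ring⟩

/-- [cite: FordGreenKonyaginMaynardTao2018, Lemma 6.2 (proof) p. 19] -/
theorem card_pairSet {i : ℤ × ℕ} (hi : i.2 ≠ 0) (q : ℤ) : #(pairSet H q i) = #H :=
  card_shiftSet H hi _

/-- `1_{q ∈ S(a⃗)} · 1_{T ⊆ S(a⃗)} = 1_{T ⊆ S(a⃗)}` for the pair sets `T ∋ q`.
[cite: FordGreenKonyaginMaynardTao2018, Lemma 6.2 (proof) p. 19] -/
theorem siftInd_singleton_mul_pairSet {q : ℤ} {i : ℤ × ℕ} (hi : i.1 ∈ H)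
    (f : (s : ℕ) → s ∈ S → ℕ) :
    siftInd S {q} f * siftInd S (pairSet H q i) f = siftInd S (pairSet H q i) f := by
  rw [siftInd_mul, Finset.union_eq_right.2 (Finset.singleton_subset_iff.2 (self_mem_pairSet hi))]

/-- **`1_{q ∈ S(a⃗)} Y_q(a⃗) = Y_q(a⃗)`**: the sum over `q ∈ 𝒬 ∩ S(a⃗)` of `Y_q` (or `Y_q²`) is the
sum over `q ∈ 𝒬`. [cite: FordGreenKonyaginMaynardTao2018, Lemma 6.2 (proof) p. 19] -/
theorem siftInd_singleton_mul_Ylaw (f : (s : ℕ) → s ∈ S → ℕ) (q : ℤ) :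
    siftInd S {q} f * Ylaw S P H lam f q = Ylaw S P H lam f q := by
  unfold Ylaw
  rw [Finset.mul_sum]
  refine Finset.sum_congr rfl fun i hi => ?_
  rw [Finset.mem_product] at hi
  rw [mul_left_comm, siftInd_singleton_mul_pairSet hi.1]

/-! ### First moment -/

/-- `E Y_q = Σ_{(h,p)} λ_p(q − hp) P({q + (h' − h)p} ⊆ S(a⃗))`.
[cite: FordGreenKonyaginMaynardTao2018, Lemma 6.2 (proof) p. 19] -/
theorem boxExp_Ylaw (S : Finset ℕ) (P : Finset ℕ) (H : Finset ℤ) (lam : ℕ → ℤ → ℝ) (q : ℤ) :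
    boxExp S (fun f => Ylaw S P H lam f q) =
      ∑ i ∈ H ×ˢ P, lam i.2 (q - i.1 * (i.2 : ℤ)) * siftProb S (pairSet H q i) := by
  unfold Ylaw
  rw [boxExp_sum]
  refine Finset.sum_congr rfl fun i _ => ?_
  rw [boxExp_const_mul, boxExp_siftInd]

/-- `E Y_q ≥ σ^r e^{-2r² Σ 1/s²} A_q`. [cite: FordGreenKonyaginMaynardTao2018, Lemma 6.2 (proof) p. 19] -/
theorem boxExp_Ylaw_ge (hS : ∀ s ∈ S, 0 < s) (hP : ∀ p ∈ P, p ≠ 0) (h2r : ∀ s ∈ S, 2 * #H ≤ s)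
    (hlam : ∀ p n, 0 ≤ lam p n) (q : ℤ) :
    sigmaProd S ^ #H * Real.exp (-(2 * (#H : ℝ) ^ 2 * ∑ s ∈ S, 1 / (s : ℝ) ^ 2)) * Alaw P H lam q
      ≤ boxExp S (fun f => Ylaw S P H lam f q) := by
  rw [boxExp_Ylaw, Alaw, Finset.mul_sum]
  refine Finset.sum_le_sum fun i hi => ?_
  rw [Finset.mem_product] at hi
  rw [mul_comm]
  refine mul_le_mul_of_nonneg_left ?_ (hlam _ _)
  have hc : #(pairSet H q i) = #H := card_pairSet (hP _ hi.2) q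
  have h := lemma61_lower hS (T := pairSet H q i) (by intro s hs; rw [hc]; exact h2r s hs)
  rwa [hc] at h

/-- `E Y_q ≤ σ^r A_q/(1 − δ_r)`, where `M` bounds `|m − m'|` for `m, m'` in the pair sets at `q`.
[cite: FordGreenKonyaginMaynardTao2018, Lemma 6.2 (proof) p. 19] -/
theorem boxExp_Ylaw_le (hS : ∀ s ∈ S, s.Prime) {s₀ : ℕ} (hs₀ : 2 ≤ s₀) (hSs₀ : ∀ s ∈ S, s₀ ≤ s)
    (hP : ∀ p ∈ P, p ≠ 0) (hlam : ∀ p n, 0 ≤ lam p n) {q : ℤ} {M : ℝ} (hM1 : 1 ≤ M)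
    (hM : ∀ i ∈ H ×ˢ P, ∀ j ∈ H ×ˢ P, ∀ m ∈ pairSet H q i, ∀ m' ∈ pairSet H q j,
      (|m - m'| : ℝ) ≤ M)
    (hr : #H ≤ s₀) (hδ : (#H : ℝ) ^ 3 * Real.log M / (s₀ * Real.log s₀) < 1) :
    boxExp S (fun f => Ylaw S P H lam f q) ≤
      sigmaProd S ^ #H / (1 - (#H : ℝ) ^ 3 * Real.log M / (s₀ * Real.log s₀)) * Alaw P H lam q := by
  rw [boxExp_Ylaw, Alaw, Finset.mul_sum]
  refine Finset.sum_le_sum fun i hi => ?_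
  have hi' := Finset.mem_product.1 hi
  rw [mul_comm]
  refine mul_le_mul_of_nonneg_right ?_ (hlam _ _)
  have hc : #(pairSet H q i) = #H := card_pairSet (hP _ hi'.2) q
  have h := lemma61_upper_mono hS hs₀ hSs₀ hM1 (hM i hi i hi) hc.symm.le hc.le hr hδ
  exact h

/-! ### Second moment -/

/-- `Y_q² = Σ_{i,j} λ_i λ_j 1_{T_i ∪ T_j ⊆ S(a⃗)}`. [cite: FordGreenKonyaginMaynardTao2018, Lemma 6.2 (proof) p. 19] -/
theorem Ylaw_sq (S : Finset ℕ) (P : Finset ℕ) (H : Finset ℤ) (lam : ℕ → ℤ → ℝ)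
    (f : (s : ℕ) → s ∈ S → ℕ) (q : ℤ) :
    Ylaw S P H lam f q ^ 2 = ∑ i ∈ H ×ˢ P, ∑ j ∈ H ×ˢ P,
      lam i.2 (q - i.1 * (i.2 : ℤ)) * lam j.2 (q - j.1 * (j.2 : ℤ)) *
        siftInd S (pairSet H q i ∪ pairSet H q j) f := by
  unfold Ylaw
  rw [sq, Finset.sum_mul_sum]
  refine Finset.sum_congr rfl fun i _ => Finset.sum_congr rfl fun j _ => ?_
  rw [← siftInd_mul]
  ring

/-- `E Y_q² = Σ_{i,j} λ_i λ_j P(T_i ∪ T_j ⊆ S(a⃗))`. [cite: FordGreenKonyaginMaynardTao2018, Lemma 6.2 (proof) p. 19] -/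
theorem boxExp_Ylaw_sq (S : Finset ℕ) (P : Finset ℕ) (H : Finset ℤ) (lam : ℕ → ℤ → ℝ) (q : ℤ) :
    boxExp S (fun f => Ylaw S P H lam f q ^ 2) = ∑ i ∈ H ×ˢ P, ∑ j ∈ H ×ˢ P,
      lam i.2 (q - i.1 * (i.2 : ℤ)) * lam j.2 (q - j.1 * (j.2 : ℤ)) *
        siftProb S (pairSet H q i ∪ pairSet H q j) := by
  simp_rw [Ylaw_sq]
  rw [boxExp_sum]
  refine Finset.sum_congr rfl fun i _ => ?_
  rw [boxExp_sum]
  refine Finset.sum_congr rfl fun j _ => ?_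
  rw [boxExp_const_mul, boxExp_siftInd]

/-- Under the cross-prime hypothesis, pair sets at `q` for DIFFERENT primes meet only in `q`.
[cite: FordGreenKonyaginMaynardTao2018, Lemma 6.2 (proof) p. 19] -/
theorem inter_pairSet_subset
    (hcross : ∀ p₁ ∈ P, ∀ p₂ ∈ P, p₁ ≠ p₂ → ∀ h₁ ∈ H, ∀ h₁' ∈ H, ∀ h₂ ∈ H, ∀ h₂' ∈ H,
      (h₁' - h₁) * (p₁ : ℤ) = (h₂' - h₂) * (p₂ : ℤ) → h₁' = h₁)
    {q : ℤ} {i j : ℤ × ℕ} (hi : i ∈ H ×ˢ P) (hj : j ∈ H ×ˢ P) (hne : i.2 ≠ j.2) :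
    pairSet H q i ∩ pairSet H q j ⊆ {q} := by
  intro m hm
  rw [Finset.mem_inter] at hm
  rw [Finset.mem_product] at hi hj
  obtain ⟨h₁', hh₁', hm₁⟩ := mem_shiftSet.1 hm.1
  obtain ⟨h₂', hh₂', hm₂⟩ := mem_shiftSet.1 hm.2
  have heq : (h₁' - i.1) * (i.2 : ℤ) = (h₂' - j.1) * (j.2 : ℤ) := by linarith
  have := hcross i.2 hi.2 j.2 hj.2 hne i.1 hi.1 h₁' hh₁' j.1 hj.1 h₂' hh₂' heq
  rw [Finset.mem_singleton, ← hm₁, this]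
  ring

/-- `2r − 1 ≤ #(T_i ∪ T_j)` for pairs with different primes.
[cite: FordGreenKonyaginMaynardTao2018, Lemma 6.2 (proof) p. 19] -/
theorem card_union_pairSet_ge (hP : ∀ p ∈ P, p ≠ 0)
    (hcross : ∀ p₁ ∈ P, ∀ p₂ ∈ P, p₁ ≠ p₂ → ∀ h₁ ∈ H, ∀ h₁' ∈ H, ∀ h₂ ∈ H, ∀ h₂' ∈ H,
      (h₁' - h₁) * (p₁ : ℤ) = (h₂' - h₂) * (p₂ : ℤ) → h₁' = h₁)
    {q : ℤ} {i j : ℤ × ℕ} (hi : i ∈ H ×ˢ P) (hj : j ∈ H ×ˢ P) (hne : i.2 ≠ j.2) :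
    2 * #H - 1 ≤ #(pairSet H q i ∪ pairSet H q j) := by
  have hi' := Finset.mem_product.1 hi
  have hj' := Finset.mem_product.1 hj
  have hinter : #(pairSet H q i ∩ pairSet H q j) ≤ 1 := by
    calc #(pairSet H q i ∩ pairSet H q j) ≤ #({q} : Finset ℤ) :=
          Finset.card_le_card (inter_pairSet_subset hcross hi hj hne)
      _ = 1 := Finset.card_singleton q
  have h := Finset.card_union_add_card_inter (pairSet H q i) (pairSet H q j)
  rw [card_pairSet (hP _ hi'.2), card_pairSet (hP _ hj'.2)] at h
  omega

/-- [cite: FordGreenKonyaginMaynardTao2018, Lemma 6.2 (proof) p. 19] -/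
theorem card_union_pairSet_le (hP : ∀ p ∈ P, p ≠ 0) {q : ℤ} {i j : ℤ × ℕ} (hi : i ∈ H ×ˢ P)
    (hj : j ∈ H ×ˢ P) : #(pairSet H q i ∪ pairSet H q j) ≤ 2 * #H := by
  have hi' := Finset.mem_product.1 hi
  have hj' := Finset.mem_product.1 hj
  calc #(pairSet H q i ∪ pairSet H q j) ≤ #(pairSet H q i) + #(pairSet H q j) :=
        Finset.card_union_le _ _
    _ = 2 * #H := by rw [card_pairSet (hP _ hi'.2), card_pairSet (hP _ hj'.2)]; ring

/-- The pairs `j = (h₂, p₁)` sharing the prime of `i = (h₁, p₁)` number at most `r`.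
[cite: FordGreenKonyaginMaynardTao2018, Lemma 6.2 (proof) p. 19] -/
theorem card_filter_snd_eq_le (H : Finset ℤ) (P : Finset ℕ) (p₁ : ℕ) :
    #((H ×ˢ P).filter fun j : ℤ × ℕ => j.2 = p₁) ≤ #H := by
  classical
  calc #((H ×ˢ P).filter fun j : ℤ × ℕ => j.2 = p₁) ≤ #(H ×ˢ ({p₁} : Finset ℕ)) := by
        refine Finset.card_le_card fun j hj => ?_
        rw [Finset.mem_filter, Finset.mem_product] at hj
        rw [Finset.mem_product, Finset.mem_singleton]
        exact ⟨hj.1.1, hj.2⟩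
    _ = #H := by rw [Finset.card_product, Finset.card_singleton, mul_one]

/-- **Second moment of `Y_q`**: `E Y_q² ≤ A_q (σ^{2r−1} A_q + σ^r r Λ)/(1 − δ_{2r})`,
`δ_{2r} = (2r)³ log M/(s₀ log s₀)` — pairs with different primes have `≥ 2r − 1` points
(`hcross`), pairs with the same prime (at most `r` per `i`, weight `≤ Λ` each) are bounded through
`P(T_i ∪ T_j ⊆ S) ≤ P(T_i ⊆ S) ≤ σ^r/(1 − δ)` («the terms with `p₁ = p₂` contribute negligibly»).
[cite: FordGreenKonyaginMaynardTao2018, Lemma 6.2 (proof) p. 19] -/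
theorem boxExp_Ylaw_sq_le (hS : ∀ s ∈ S, s.Prime) {s₀ : ℕ} (hs₀ : 2 ≤ s₀)
    (hSs₀ : ∀ s ∈ S, s₀ ≤ s) (hP : ∀ p ∈ P, p ≠ 0)
    (hcross : ∀ p₁ ∈ P, ∀ p₂ ∈ P, p₁ ≠ p₂ → ∀ h₁ ∈ H, ∀ h₁' ∈ H, ∀ h₂ ∈ H, ∀ h₂' ∈ H,
      (h₁' - h₁) * (p₁ : ℤ) = (h₂' - h₂) * (p₂ : ℤ) → h₁' = h₁)
    (hlam : ∀ p n, 0 ≤ lam p n) {Λ : ℝ} (hΛ : ∀ p n, lam p n ≤ Λ) (hH : 1 ≤ #H) {q : ℤ} {M : ℝ}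
    (hM1 : 1 ≤ M)
    (hM : ∀ i ∈ H ×ˢ P, ∀ j ∈ H ×ˢ P, ∀ m ∈ pairSet H q i, ∀ m' ∈ pairSet H q j,
      (|m - m'| : ℝ) ≤ M)
    (h2r : 2 * #H ≤ s₀) (hδ₂ : (2 * (#H : ℝ)) ^ 3 * Real.log M / (s₀ * Real.log s₀) < 1) :
    boxExp S (fun f => Ylaw S P H lam f q ^ 2) ≤
      Alaw P H lam q * ((sigmaProd S ^ (2 * #H - 1) * Alaw P H lam q +
        sigmaProd S ^ #H * (#H * Λ)) / (1 - (2 * (#H : ℝ)) ^ 3 * Real.log M / (s₀ * Real.log s₀))) := by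
  classical
  have hS0 : ∀ s ∈ S, 0 < s := fun s hs => (hS s hs).pos
  set δ₂ : ℝ := (2 * (#H : ℝ)) ^ 3 * Real.log M / (s₀ * Real.log s₀) with hδ₂def
  set σ : ℝ := sigmaProd S with hσdef
  have hσ0 : 0 ≤ σ := sigmaProd_nonneg hS0
  have h1δ₂ : 0 < 1 - δ₂ := by linarith
  have hΛ0 : 0 ≤ Λ := (hlam 0 0).trans (hΛ 0 0)
  have hA0 : 0 ≤ Alaw P H lam q := Alaw_nonneg hlam q
  have hcast2r : ((2 * #H : ℕ) : ℝ) = 2 * (#H : ℝ) := by push_cast; ring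
  -- union diameter bound
  have hdiamU : ∀ i ∈ H ×ˢ P, ∀ j ∈ H ×ˢ P, ∀ m ∈ pairSet H q i ∪ pairSet H q j,
      ∀ m' ∈ pairSet H q i ∪ pairSet H q j, (|m - m'| : ℝ) ≤ M := by
    intro i hi j hj m hm m' hm'
    rw [Finset.mem_union] at hm hm'
    rcases hm with hm | hm <;> rcases hm' with hm' | hm'
    · exact hM i hi i hi m hm m' hm'
    · exact hM i hi j hj m hm m' hm'
    · exact hM j hj i hi m hm m' hm'
    · exact hM j hj j hj m hm m' hm'
  -- bound for pairs with different primes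
  have hdiff : ∀ i ∈ H ×ˢ P, ∀ j ∈ H ×ˢ P, i.2 ≠ j.2 →
      siftProb S (pairSet H q i ∪ pairSet H q j) ≤ σ ^ (2 * #H - 1) / (1 - δ₂) := by
    intro i hi j hj hne
    have h := lemma61_upper_mono hS hs₀ hSs₀ hM1 (hdiamU i hi j hj)
      (card_union_pairSet_ge hP hcross hi hj hne) (card_union_pairSet_le hP hi hj) h2r
      (by rw [hcast2r]; exact hδ₂)
    rwa [hcast2r] at h
  -- bound for any pair (used for equal primes)
  have hsame : ∀ i ∈ H ×ˢ P, ∀ j ∈ H ×ˢ P,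
      siftProb S (pairSet H q i ∪ pairSet H q j) ≤ σ ^ #H / (1 - δ₂) := by
    intro i hi j hj
    have hi' := Finset.mem_product.1 hi
    refine (siftProb_anti hS0 Finset.subset_union_left).trans ?_
    have hc : #(pairSet H q i) = #H := card_pairSet (hP _ hi'.2) q
    have h := lemma61_upper_mono hS hs₀ hSs₀ hM1 (hM i hi i hi) hc.symm.le
      (hc.le.trans (by omega : #H ≤ 2 * #H)) h2r (by rw [hcast2r]; exact hδ₂)
    rwa [hcast2r] at h
  have hB1 : 0 ≤ σ ^ (2 * #H - 1) / (1 - δ₂) := div_nonneg (pow_nonneg hσ0 _) h1δ₂.le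
  have hB2 : 0 ≤ σ ^ #H / (1 - δ₂) := div_nonneg (pow_nonneg hσ0 _) h1δ₂.le
  rw [boxExp_Ylaw_sq]
  -- rewrite the target as a sum over i
  have htarget : Alaw P H lam q * ((σ ^ (2 * #H - 1) * Alaw P H lam q + σ ^ #H * (#H * Λ)) / (1 - δ₂)) =
      ∑ i ∈ H ×ˢ P, lam i.2 (q - i.1 * (i.2 : ℤ)) *
        (σ ^ (2 * #H - 1) / (1 - δ₂) * Alaw P H lam q + σ ^ #H / (1 - δ₂) * (#H * Λ)) := by
    rw [Alaw, Finset.sum_mul]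
    refine Finset.sum_congr rfl fun i _ => ?_
    rw [← Alaw]
    field_simp
  rw [htarget]
  refine Finset.sum_le_sum fun i hi => ?_
  have hrw : ∑ j ∈ H ×ˢ P, lam i.2 (q - i.1 * (i.2 : ℤ)) * lam j.2 (q - j.1 * (j.2 : ℤ)) *
        siftProb S (pairSet H q i ∪ pairSet H q j) =
      lam i.2 (q - i.1 * (i.2 : ℤ)) * ∑ j ∈ H ×ˢ P, lam j.2 (q - j.1 * (j.2 : ℤ)) *
        siftProb S (pairSet H q i ∪ pairSet H q j) := by
    rw [Finset.mul_sum]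
    exact Finset.sum_congr rfl fun j _ => by ring
  rw [hrw]
  refine mul_le_mul_of_nonneg_left ?_ (hlam _ _)
  rw [← Finset.sum_filter_add_sum_filter_not (H ×ˢ P) (fun j : ℤ × ℕ => j.2 = i.2)]
  rw [add_comm]
  refine add_le_add ?_ ?_
  · -- different primes
    calc ∑ j ∈ (H ×ˢ P).filter (fun j : ℤ × ℕ => ¬ j.2 = i.2),
            lam j.2 (q - j.1 * (j.2 : ℤ)) * siftProb S (pairSet H q i ∪ pairSet H q j)
          ≤ ∑ j ∈ (H ×ˢ P).filter (fun j : ℤ × ℕ => ¬ j.2 = i.2),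
            lam j.2 (q - j.1 * (j.2 : ℤ)) * (σ ^ (2 * #H - 1) / (1 - δ₂)) := by
            refine Finset.sum_le_sum fun j hj => ?_
            rw [Finset.mem_filter] at hj
            exact mul_le_mul_of_nonneg_left (hdiff i hi j hj.1 (Ne.symm hj.2)) (hlam _ _)
      _ = σ ^ (2 * #H - 1) / (1 - δ₂) * ∑ j ∈ (H ×ˢ P).filter (fun j : ℤ × ℕ => ¬ j.2 = i.2),
            lam j.2 (q - j.1 * (j.2 : ℤ)) := by
            rw [Finset.mul_sum]; exact Finset.sum_congr rfl fun _ _ => mul_comm _ _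
      _ ≤ σ ^ (2 * #H - 1) / (1 - δ₂) * Alaw P H lam q := by
            refine mul_le_mul_of_nonneg_left ?_ hB1
            exact Finset.sum_le_sum_of_subset_of_nonneg (Finset.filter_subset _ _)
              fun j _ _ => hlam _ _
  · -- same prime
    calc ∑ j ∈ (H ×ˢ P).filter (fun j : ℤ × ℕ => j.2 = i.2),
            lam j.2 (q - j.1 * (j.2 : ℤ)) * siftProb S (pairSet H q i ∪ pairSet H q j)
          ≤ ∑ j ∈ (H ×ˢ P).filter (fun j : ℤ × ℕ => j.2 = i.2), Λ * (σ ^ #H / (1 - δ₂)) := by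
            refine Finset.sum_le_sum fun j hj => ?_
            rw [Finset.mem_filter] at hj
            exact mul_le_mul (hΛ _ _) (hsame i hi j hj.1) (siftProb_nonneg S _) hΛ0
      _ = #((H ×ˢ P).filter (fun j : ℤ × ℕ => j.2 = i.2)) * (Λ * (σ ^ #H / (1 - δ₂))) := by
            rw [Finset.sum_const, nsmul_eq_mul]
      _ ≤ (#H : ℝ) * (Λ * (σ ^ #H / (1 - δ₂))) := by
            refine mul_le_mul_of_nonneg_right ?_ (mul_nonneg hΛ0 hB2)
            exact_mod_cast card_filter_snd_eq_le H P i.2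
      _ = σ ^ #H / (1 - δ₂) * (#H * Λ) := by ring

/-! ### The centred second moment over `q ∈ 𝒬 ∩ S(a⃗)` -/

/-- `E 1_{q ∈ S(a⃗)} = σ`. [cite: FordGreenKonyaginMaynardTao2018, (6.9) p. 17] -/
theorem boxExp_siftInd_singleton (hS : ∀ s ∈ S, 0 < s) (q : ℤ) :
    boxExp S (siftInd S {q}) = sigmaProd S := by
  rw [boxExp_siftInd, siftProb_singleton_eq_sigmaProd hS]

/-- Pointwise expansion: `1_q (Y_q − m')² = Y_q² − 2m' Y_q + m'² 1_q` (as `1_q Y_q = Y_q`, `1_q² = 1_q`).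
[cite: FordGreenKonyaginMaynardTao2018, Lemma 6.2 (proof) p. 19] -/
theorem siftInd_mul_sq_sub (f : (s : ℕ) → s ∈ S → ℕ) (q : ℤ) (m' : ℝ) :
    siftInd S {q} f * (Ylaw S P H lam f q - m') ^ 2 =
      (Ylaw S P H lam f q ^ 2 - 2 * m' * Ylaw S P H lam f q) + m' ^ 2 * siftInd S {q} f := by
  have h1 := siftInd_singleton_mul_Ylaw (P := P) (H := H) (lam := lam) f q
  have hsq : siftInd S {q} f * Ylaw S P H lam f q ^ 2 = Ylaw S P H lam f q ^ 2 := by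
    rw [sq, ← mul_assoc, h1]
  calc siftInd S {q} f * (Ylaw S P H lam f q - m') ^ 2
        = siftInd S {q} f * Ylaw S P H lam f q ^ 2 - 2 * m' * (siftInd S {q} f * Ylaw S P H lam f q)
            + m' ^ 2 * siftInd S {q} f := by ring
    _ = _ := by rw [hsq, h1]

/-- **`E Σ_{q ∈ 𝒬 ∩ S(a⃗)} (Y_q − m')² = Σ_q (E Y_q² − 2m' E Y_q + m'² σ)`** (exact).
[cite: FordGreenKonyaginMaynardTao2018, Lemma 6.2 (proof) p. 19] -/
theorem boxExp_sum_sq_dev (hS : ∀ s ∈ S, 0 < s) (Q : Finset ℤ) (m' : ℝ) :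
    boxExp S (fun f => ∑ q ∈ Q, siftInd S {q} f * (Ylaw S P H lam f q - m') ^ 2) =
      ∑ q ∈ Q, (boxExp S (fun f => Ylaw S P H lam f q ^ 2)
        - 2 * m' * boxExp S (fun f => Ylaw S P H lam f q) + m' ^ 2 * sigmaProd S) := by
  rw [boxExp_sum]
  refine Finset.sum_congr rfl fun q _ => ?_
  simp_rw [siftInd_mul_sq_sub]
  rw [boxExp_add, boxExp_sub, boxExp_const_mul, boxExp_const_mul, boxExp_siftInd_singleton hS]

/-- **Lemma 6.2 (engine), second-moment form.** If `A_q = (1 + O_≤(ε)) m` for `q ∈ Q`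
(`ε ≥ 0`, `m ≥ 0`; (6.6)), then with `m' = σ^{r−1} m`:
`E Σ_{q ∈ Q ∩ S(a⃗)} (Y_q − m')² ≤ #Q · (σ^{2r−1} m² ((1+ε)²/(1 − δ_{2r}) − 2(1 − ε) e^{-2r²Σ1/s²} + 1)
  + σ^r r Λ (1 + ε) m/(1 − δ_{2r}))`.
[cite: FordGreenKonyaginMaynardTao2018, Lemma 6.2 p. 18] -/
theorem boxExp_sum_sq_dev_le (hS : ∀ s ∈ S, s.Prime) {s₀ : ℕ} (hs₀ : 2 ≤ s₀)
    (hSs₀ : ∀ s ∈ S, s₀ ≤ s) (hP : ∀ p ∈ P, p ≠ 0)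
    (hcross : ∀ p₁ ∈ P, ∀ p₂ ∈ P, p₁ ≠ p₂ → ∀ h₁ ∈ H, ∀ h₁' ∈ H, ∀ h₂ ∈ H, ∀ h₂' ∈ H,
      (h₁' - h₁) * (p₁ : ℤ) = (h₂' - h₂) * (p₂ : ℤ) → h₁' = h₁)
    (hlam : ∀ p n, 0 ≤ lam p n) {Λ : ℝ} (hΛ : ∀ p n, lam p n ≤ Λ) (hH : 1 ≤ #H) {Q : Finset ℤ}
    {M : ℝ} (hM1 : 1 ≤ M)
    (hM : ∀ q ∈ Q, ∀ i ∈ H ×ˢ P, ∀ j ∈ H ×ˢ P, ∀ m ∈ pairSet H q i, ∀ m' ∈ pairSet H q j,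
      (|m - m'| : ℝ) ≤ M)
    (h2r : 2 * #H ≤ s₀) (hδ₂ : (2 * (#H : ℝ)) ^ 3 * Real.log M / (s₀ * Real.log s₀) < 1)
    {m ε : ℝ} (hm : 0 ≤ m) (hε : 0 ≤ ε)
    (hA : ∀ q ∈ Q, |Alaw P H lam q - m| ≤ ε * m) :
    boxExp S (fun f => ∑ q ∈ Q,
        siftInd S {q} f * (Ylaw S P H lam f q - sigmaProd S ^ (#H - 1) * m) ^ 2) ≤
      #Q * (sigmaProd S ^ (2 * #H - 1) * m ^ 2 *
          ((1 + ε) ^ 2 / (1 - (2 * (#H : ℝ)) ^ 3 * Real.log M / (s₀ * Real.log s₀)) -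
            2 * (1 - ε) * Real.exp (-(2 * (#H : ℝ) ^ 2 * ∑ s ∈ S, 1 / (s : ℝ) ^ 2)) + 1) +
        sigmaProd S ^ #H * (#H * Λ) * ((1 + ε) * m) /
          (1 - (2 * (#H : ℝ)) ^ 3 * Real.log M / (s₀ * Real.log s₀))) := by
  have hS0 : ∀ s ∈ S, 0 < s := fun s hs => (hS s hs).pos
  set δ₂ : ℝ := (2 * (#H : ℝ)) ^ 3 * Real.log M / (s₀ * Real.log s₀) with hδ₂def
  set σ : ℝ := sigmaProd S with hσdef
  set L : ℝ := Real.exp (-(2 * (#H : ℝ) ^ 2 * ∑ s ∈ S, 1 / (s : ℝ) ^ 2)) with hLdef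
  have hσ0 : 0 ≤ σ := sigmaProd_nonneg hS0
  have h1δ₂ : 0 < 1 - δ₂ := by linarith
  have hΛ0 : 0 ≤ Λ := (hlam 0 0).trans (hΛ 0 0)
  have hL0 : 0 ≤ L := (Real.exp_pos _).le
  have hconst : ∀ X : ℝ, ∑ _q ∈ Q, X = #Q * X := fun X => by
    rw [Finset.sum_const, nsmul_eq_mul]
  rw [boxExp_sum_sq_dev hS0, ← hconst, ← hσdef]
  refine Finset.sum_le_sum fun q hq => ?_
  have hAq := hA q hq
  rw [abs_le] at hAq
  have hA0 : 0 ≤ Alaw P H lam q := Alaw_nonneg hlam q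
  have hAup : Alaw P H lam q ≤ (1 + ε) * m := by linarith [hAq.2]
  have hAlo : (1 - ε) * m ≤ Alaw P H lam q := by linarith [hAq.1]
  -- the three expectations
  have h2 := boxExp_Ylaw_sq_le hS hs₀ hSs₀ hP hcross hlam hΛ hH hM1 (hM q hq) h2r hδ₂
  rw [← hδ₂def, ← hσdef] at h2
  have h1 := boxExp_Ylaw_ge hS0 hP (fun s hs => le_trans h2r (hSs₀ s hs)) hlam q
    (P := P) (H := H) (lam := lam)
  rw [← hσdef, ← hLdef] at h1
  -- powers of σ
  have hpow1 : σ ^ (#H - 1) * σ ^ #H = σ ^ (2 * #H - 1) := by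
    rw [← pow_add]; congr 1; omega
  have hpow2 : (σ ^ (#H - 1) * m) ^ 2 * σ = σ ^ (2 * #H - 1) * m ^ 2 := by
    have : (σ ^ (#H - 1)) ^ 2 * σ = σ ^ (2 * #H - 1) := by
      rw [← pow_mul, ← pow_succ]; congr 1; omega
    calc (σ ^ (#H - 1) * m) ^ 2 * σ = (σ ^ (#H - 1)) ^ 2 * σ * m ^ 2 := by ring
      _ = σ ^ (2 * #H - 1) * m ^ 2 := by rw [this]
  have hm'0 : 0 ≤ 2 * (σ ^ (#H - 1) * m) := by positivity
  -- -2 m' E Y ≤ -2 m' σ^r L A ≤ -2 m' σ^r L (1-ε) m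
  have h1' : 2 * (σ ^ (#H - 1) * m) * (σ ^ #H * L * ((1 - ε) * m)) ≤
      2 * (σ ^ (#H - 1) * m) * boxExp S (fun f => Ylaw S P H lam f q) := by
    refine mul_le_mul_of_nonneg_left (le_trans ?_ h1) hm'0
    exact mul_le_mul_of_nonneg_left hAlo (mul_nonneg (pow_nonneg hσ0 _) hL0)
  -- E Y² ≤ A (σ^{2r-1} A + σ^r rΛ)/(1-δ₂) ≤ (1+ε) m (σ^{2r-1}(1+ε) m + σ^r rΛ)/(1-δ₂)
  have h2' : boxExp S (fun f => Ylaw S P H lam f q ^ 2) ≤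
      (1 + ε) * m * ((σ ^ (2 * #H - 1) * ((1 + ε) * m) + σ ^ #H * (#H * Λ)) / (1 - δ₂)) := by
    refine h2.trans ?_
    have hin0 : 0 ≤ (σ ^ (2 * #H - 1) * Alaw P H lam q + σ ^ #H * (#H * Λ)) / (1 - δ₂) :=
      div_nonneg (by positivity) h1δ₂.le
    refine (mul_le_mul_of_nonneg_right hAup hin0).trans ?_
    refine mul_le_mul_of_nonneg_left ?_ (by positivity)
    refine div_le_div_of_nonneg_right ?_ h1δ₂.le
    nlinarith [pow_nonneg hσ0 (2 * #H - 1)]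
  -- assemble
  have hkey : σ ^ (2 * #H - 1) * m ^ 2 * ((1 + ε) ^ 2 / (1 - δ₂) - 2 * (1 - ε) * L + 1) +
      σ ^ #H * (#H * Λ) * ((1 + ε) * m) / (1 - δ₂) =
      (1 + ε) * m * ((σ ^ (2 * #H - 1) * ((1 + ε) * m) + σ ^ #H * (#H * Λ)) / (1 - δ₂))
        - 2 * (σ ^ (#H - 1) * m) * (σ ^ #H * L * ((1 - ε) * m)) + (σ ^ (#H - 1) * m) ^ 2 * σ := by
    rw [hpow2]
    have : 2 * (σ ^ (#H - 1) * m) * (σ ^ #H * L * ((1 - ε) * m)) =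
        2 * (1 - ε) * L * m ^ 2 * (σ ^ (#H - 1) * σ ^ #H) := by ring
    rw [this, hpow1]
    field_simp
    ring
  rw [hkey]
  linarith [h1', h2']

/-! ### Counting: Markov over `a⃗`, Chebyshev over `q` -/

/-- **Markov over the box**: `#{a⃗ : Σ_{q ∈ Q ∩ S(a⃗)} (Y_q − m')² ≥ t} ≤ E[…]/t · ∏ s`.
[cite: FordGreenKonyaginMaynardTao2018, Lemma 6.2 (proof) p. 19] -/
theorem count_box_sq_dev (hS : ∀ s ∈ S, 0 < s) (Q : Finset ℤ) (m' : ℝ) {t : ℝ} (ht : 0 < t) :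
    (#((residueBox S).filter fun f =>
        t ≤ ∑ q ∈ Q, siftInd S {q} f * (Ylaw S P H lam f q - m') ^ 2) : ℝ) ≤
      boxExp S (fun f => ∑ q ∈ Q, siftInd S {q} f * (Ylaw S P H lam f q - m') ^ 2) / t *
        ∏ s ∈ S, (s : ℝ) :=
  card_box_filter_le hS _
    (fun f _ => Finset.sum_nonneg fun _ _ => mul_nonneg (siftInd_nonneg S _ f) (sq_nonneg _)) ht

/-- **Chebyshev over `q` (deterministic)**: for every `a⃗` and `κ > 0`, the number of `q ∈ Q` with
`q ∈ S(a⃗)` (`1_q = 1`) and `|Y_q − m'| ≥ κ` is at most `Σ_{q ∈ Q} 1_q (Y_q − m')²/κ²`.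
[cite: FordGreenKonyaginMaynardTao2018, Lemma 6.2 (proof) p. 19 («By Chebyshev's inequality it
follows that the number of bad `q` is …»)] -/
theorem card_bad_le (f : (s : ℕ) → s ∈ S → ℕ) (Q : Finset ℤ) (m' : ℝ) {κ : ℝ} (hκ : 0 < κ) :
    (#(Q.filter fun q => siftInd S {q} f = 1 ∧ κ ≤ |Ylaw S P H lam f q - m'|) : ℝ) ≤
      (∑ q ∈ Q, siftInd S {q} f * (Ylaw S P H lam f q - m') ^ 2) / κ ^ 2 := by
  classical
  rw [le_div_iff₀ (by positivity)]
  calc (#(Q.filter fun q => siftInd S {q} f = 1 ∧ κ ≤ |Ylaw S P H lam f q - m'|) : ℝ) * κ ^ 2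
        = ∑ q ∈ Q.filter (fun q => siftInd S {q} f = 1 ∧ κ ≤ |Ylaw S P H lam f q - m'|), κ ^ 2 := by
          rw [Finset.sum_const, nsmul_eq_mul]
    _ ≤ ∑ q ∈ Q.filter (fun q => siftInd S {q} f = 1 ∧ κ ≤ |Ylaw S P H lam f q - m'|),
          siftInd S {q} f * (Ylaw S P H lam f q - m') ^ 2 := by
          refine Finset.sum_le_sum fun q hq => ?_
          rw [Finset.mem_filter] at hq
          rw [hq.2.1, one_mul]
          have h := pow_le_pow_left₀ hκ.le hq.2.2 2
          rwa [sq_abs] at h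
    _ ≤ ∑ q ∈ Q, siftInd S {q} f * (Ylaw S P H lam f q - m') ^ 2 :=
          Finset.sum_le_sum_of_subset_of_nonneg (Finset.filter_subset _ _)
            fun q _ _ => mul_nonneg (siftInd_nonneg S _ f) (sq_nonneg _)

/-- `1_{q ∈ S(a⃗)} ∈ {0, 1}`, and `= 1` iff `q ∈ S(a⃗)` in the box format.
[cite: FordGreenKonyaginMaynardTao2018, §6 p. 17] -/
theorem siftInd_singleton_eq_one_iff (f : (s : ℕ) → s ∈ S → ℕ) (q : ℤ) :
    siftInd S {q} f = 1 ↔ ∀ s (h : s ∈ S), ¬ q ≡ (f s h : ℤ) [ZMOD (s : ℤ)] := by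
  unfold siftInd
  constructor
  · intro h
    by_contra hne
    rw [if_neg] at h
    · exact zero_ne_one h
    · intro hall
      exact hne fun s hs => hall s hs q (Finset.mem_singleton_self q)
  · intro h
    rw [if_pos]
    intro s hs n hn
    rw [Finset.mem_singleton] at hn
    subst hn
    exact h s hs

end FGKMT2018

end Literature.NumberTheory.Sieve
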